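import Mathlib

/-!
# Local chord–arc from a curvature bound (tools stub `stub_localChordArcTools`, line `zero-accretion-selection`)

For a `C²` unit-speed curve `X` with `‖X″‖ ≤ κ₀` one has `‖X′(u) − X′(t)‖ ≤ κ₀|u − t|`, hence
`⟪X′(u), X′(t)⟫ ≥ 1 − κ₀²(u−t)²/2`, `⟪X(u) − X(t), X′(t)⟫ ≥ |u−t| − κ₀²|u−t|³/6`, and therefore the LOCAL
CHORD–ARC inequality `‖X(u) − X(t)‖ ≥ (5/6)|u − t|` for `|u − t| ≤ 1/κ₀` — the hypothesis
`c|u−t| ≤ ‖X u − X t‖` of the LIA window assembly and of the self-induction tail, on the curvature scale.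
-/

noncomputable section

open Set MeasureTheory intervalIntegral
open scoped RealInnerProductSpace

namespace Summit.NavierStokesRegularity.NavierStokesRegularity.Theorems.SkeletonEquilibrium.ZeroAccretionSelection
set_option linter.dupNamespace false

/-- Tangent turning: `‖X′(u) − X′(t)‖ ≤ κ₀ |u − t|` when `‖X″‖ ≤ κ₀`. [folklore] -/
theorem norm_deriv_sub_deriv_le {E : Type*} [NormedAddCommGroup E] [NormedSpace ℝ E] {X : ℝ → E}
    (hX : ContDiff ℝ 2 X) {κ₀ : ℝ} (hκ : ∀ s, ‖deriv (deriv X) s‖ ≤ κ₀) (u t : ℝ) :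
    ‖deriv X u - deriv X t‖ ≤ κ₀ * |u - t| := by
  have hd : Differentiable ℝ (deriv X) := hX.differentiable_deriv_two
  have := Convex.norm_image_sub_le_of_norm_deriv_le (s := Set.univ) (fun x _ => hd x)
    (fun x _ => hκ x) convex_univ (Set.mem_univ t) (Set.mem_univ u)
  rw [← Real.norm_eq_abs]; simpa [norm_sub_rev] using this

/-- Unit tangents stay aligned: `⟪X′(u), X′(t)⟫ ≥ 1 − κ₀²(u−t)²/2`. [folklore] -/
theorem inner_deriv_deriv_ge {E : Type*} [NormedAddCommGroup E] [InnerProductSpace ℝ E] {X : ℝ → E}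
    (hX : ContDiff ℝ 2 X) (hunit : ∀ s, ‖deriv X s‖ = 1) {κ₀ : ℝ} (hκ : ∀ s, ‖deriv (deriv X) s‖ ≤ κ₀)
    (u t : ℝ) : 1 - κ₀ ^ 2 * (u - t) ^ 2 / 2 ≤ ⟪deriv X u, deriv X t⟫ := by
  have h1 := norm_deriv_sub_deriv_le hX hκ u t
  have hκ0 : 0 ≤ κ₀ := le_trans (norm_nonneg _) (hκ 0)
  have h2 : ‖deriv X u - deriv X t‖ ^ 2 = 2 - 2 * ⟪deriv X u, deriv X t⟫ := by
    rw [← real_inner_self_eq_norm_sq, inner_sub_left, inner_sub_right, inner_sub_right,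
      real_inner_self_eq_norm_sq, real_inner_self_eq_norm_sq, hunit u, hunit t, real_inner_comm (deriv X t)]
    ring
  have h3 : ‖deriv X u - deriv X t‖ ^ 2 ≤ (κ₀ * |u - t|) ^ 2 := pow_le_pow_left₀ (norm_nonneg _) h1 2
  rw [h2, mul_pow, sq_abs] at h3
  linarith

/-- The chord projects far along the tangent: `⟪X(u) − X(t), X′(t)⟫ ≥ (u − t) − κ₀²(u−t)³/6` for `t ≤ u`.
[folklore] -/
theorem inner_chord_tangent_ge {E : Type*} [NormedAddCommGroup E] [InnerProductSpace ℝ E] [CompleteSpace E]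
    {X : ℝ → E} (hX : ContDiff ℝ 2 X) (hunit : ∀ s, ‖deriv X s‖ = 1) {κ₀ : ℝ}
    (hκ : ∀ s, ‖deriv (deriv X) s‖ ≤ κ₀) {t u : ℝ} (htu : t ≤ u) :
    (u - t) - κ₀ ^ 2 * (u - t) ^ 3 / 6 ≤ ⟪X u - X t, deriv X t⟫ := by
  have hd : Differentiable ℝ X := hX.differentiable (by norm_num)
  have hc : Continuous (deriv X) := hX.continuous_deriv (by norm_num)
  -- X u − X t = ∫ₜᵘ X′
  have hftc : X u - X t = ∫ s in t..u, deriv X s :=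
    (integral_deriv_eq_sub (fun x _ => hd x) (hc.intervalIntegrable _ _)).symm
  have hinner : ⟪∫ s in t..u, deriv X s, deriv X t⟫ = ∫ s in t..u, ⟪deriv X t, deriv X s⟫ := by
    rw [real_inner_comm, intervalIntegral.integral_of_le htu, intervalIntegral.integral_of_le htu,
      ← integral_inner ((hc.integrableOn_Icc).mono_set Set.Ioc_subset_Icc_self)]
  rw [hftc, hinner]
  -- compare with the polynomial minorant
  have hmin : ∫ s in t..u, (1 - κ₀ ^ 2 * (s - t) ^ 2 / 2) ≤ ∫ s in t..u, ⟪deriv X t, deriv X s⟫ := by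
    refine integral_mono_on htu (Continuous.intervalIntegrable (by fun_prop) _ _) ?_ fun s _ => ?_
    · exact ((continuous_const.inner hc).intervalIntegrable _ _)
    · rw [real_inner_comm]; exact inner_deriv_deriv_ge hX hunit hκ s t
  have hval : ∫ s in t..u, (1 - κ₀ ^ 2 * (s - t) ^ 2 / 2) = (u - t) - κ₀ ^ 2 * (u - t) ^ 3 / 6 := by
    have : (fun s => 1 - κ₀ ^ 2 * (s - t) ^ 2 / 2) = fun s => 1 + (-(κ₀ ^ 2 / 2)) * (s - t) ^ 2 := by
      funext s; ring
    have I1 : IntervalIntegrable (fun _ : ℝ => (1:ℝ)) volume t u := continuous_const.intervalIntegrable t u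
    have I2 : IntervalIntegrable (fun s : ℝ => (-(κ₀ ^ 2 / 2)) * (s - t) ^ 2) volume t u :=
      (by fun_prop : Continuous fun s : ℝ => (-(κ₀ ^ 2 / 2)) * (s - t) ^ 2).intervalIntegrable t u
    rw [this, integral_add I1 I2, intervalIntegral.integral_const, intervalIntegral.integral_const_mul,
      integral_comp_sub_right (fun s => s ^ 2), integral_pow]
    simp; ring
  linarith

/-- **Local chord–arc.** For a `C²` unit-speed curve with `‖X″‖ ≤ κ₀` and `|u − t| ≤ 1/κ₀` (any `u, t` when
`κ₀ = 0`… stated for `0 < κ₀`): `(5/6)|u − t| ≤ ‖X u − X t‖`. [folklore] -/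
theorem local_chord_arc {E : Type*} [NormedAddCommGroup E] [InnerProductSpace ℝ E] [CompleteSpace E]
    {X : ℝ → E} (hX : ContDiff ℝ 2 X) (hunit : ∀ s, ‖deriv X s‖ = 1) {κ₀ : ℝ} (hκ0 : 0 < κ₀)
    (hκ : ∀ s, ‖deriv (deriv X) s‖ ≤ κ₀) {u t : ℝ} (h : |u - t| ≤ 1 / κ₀) :
    5 / 6 * |u - t| ≤ ‖X u - X t‖ := by
  -- reduce to t ≤ u by symmetry
  wlog htu : t ≤ u generalizing u t
  · have h' : |t - u| ≤ 1 / κ₀ := by rwa [abs_sub_comm]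
    have := this h' (le_of_not_ge htu)
    rwa [abs_sub_comm, norm_sub_rev] at this
  have hproj := inner_chord_tangent_ge hX hunit hκ htu
  have hcs : ⟪X u - X t, deriv X t⟫ ≤ ‖X u - X t‖ := by
    have := real_inner_le_norm (X u - X t) (deriv X t)
    rwa [hunit t, mul_one] at this
  have hd : 0 ≤ u - t := by linarith
  rw [abs_of_nonneg hd] at h ⊢
  -- κ₀²(u−t)² ≤ 1 ⇒ κ₀²(u−t)³/6 ≤ (u−t)/6
  have h1 : κ₀ * (u - t) ≤ 1 := by
    have := mul_le_mul_of_nonneg_left h hκ0.le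
    rwa [mul_one_div_cancel hκ0.ne'] at this
  have h2 : κ₀ ^ 2 * (u - t) ^ 3 / 6 ≤ (u - t) / 6 := by
    have h3 : κ₀ ^ 2 * (u - t) ^ 2 ≤ 1 := by
      have := mul_le_mul h1 h1 (by positivity) zero_le_one
      nlinarith
    have : κ₀ ^ 2 * (u - t) ^ 3 = (κ₀ ^ 2 * (u - t) ^ 2) * (u - t) := by ring
    rw [this]
    have := mul_le_mul_of_nonneg_right h3 hd
    linarith
  linarith

/-- **Registered tools stub `stub_localChordArcTools`** (line `zero-accretion-selection`): tangent turning, tangent alignment,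
chord projection and the LOCAL CHORD–ARC inequality `(5/6)|u−t| ≤ ‖X u − X t‖` (`|u−t| ≤ 1/κ₀`) for `C²` unit-speed
curves with `‖X″‖ ≤ κ₀` — discharges the chord–arc hypothesis of the LIA bricks on the curvature scale. [folklore] -/
theorem stub_localChordArcTools :
    (∀ (X : ℝ → EuclideanSpace ℝ (Fin 3)) (κ₀ u t : ℝ), ContDiff ℝ 2 X → (∀ s, ‖deriv (deriv X) s‖ ≤ κ₀) →
      ‖deriv X u - deriv X t‖ ≤ κ₀ * |u - t|) ∧
    (∀ (X : ℝ → EuclideanSpace ℝ (Fin 3)) (κ₀ u t : ℝ), ContDiff ℝ 2 X → (∀ s, ‖deriv X s‖ = 1) → (∀ s, ‖deriv (deriv X) s‖ ≤ κ₀) →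
      1 - κ₀ ^ 2 * (u - t) ^ 2 / 2 ≤ ⟪deriv X u, deriv X t⟫) ∧
    (∀ (X : ℝ → EuclideanSpace ℝ (Fin 3)) (κ₀ t u : ℝ), ContDiff ℝ 2 X → (∀ s, ‖deriv X s‖ = 1) → (∀ s, ‖deriv (deriv X) s‖ ≤ κ₀) →
      t ≤ u → (u - t) - κ₀ ^ 2 * (u - t) ^ 3 / 6 ≤ ⟪X u - X t, deriv X t⟫) ∧
    (∀ (X : ℝ → EuclideanSpace ℝ (Fin 3)) (κ₀ u t : ℝ), ContDiff ℝ 2 X → (∀ s, ‖deriv X s‖ = 1) → 0 < κ₀ → (∀ s, ‖deriv (deriv X) s‖ ≤ κ₀) →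
      |u - t| ≤ 1 / κ₀ → 5 / 6 * |u - t| ≤ ‖X u - X t‖) :=
  ⟨fun _ _ u t hX hκ => norm_deriv_sub_deriv_le hX hκ u t,
    fun _ _ u t hX hunit hκ => inner_deriv_deriv_ge hX hunit hκ u t,
    fun _ _ _ _ hX hunit hκ htu => inner_chord_tangent_ge hX hunit hκ htu,
    fun _ _ _ _ hX hunit hκ0 hκ h => local_chord_arc hX hunit hκ0 hκ h⟩

end Summit.NavierStokesRegularity.NavierStokesRegularity.Theorems.SkeletonEquilibrium.ZeroAccretionSelection
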